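import Literature.Algebra.Module.SplitSurjectiveBaseChange
import HarnessLib

/-!
# The descending-induction step of «cohomology and base change» over a local ring (Mumford AV §5 Cor. 3; EGA III 7.7.10)

Topic `Algebra/Module`; namespace `Literature.Algebra.Module`; THEOREMS ONLY (Mathlib + ★ `SplitSurjectiveBaseChange`; no
definition, no named fact, no instance, no notation, no `sorry`).

Let `R` be a LOCAL ring with residue field `k`, and `P —d→ Q —e→ W` two composable linear maps with `e ∘ d = 0` (three
consecutive terms `K^{m−1} → K^m → K^{m+1}` of a complex of finite projective modules).  The INVARIANT carried down the
complex by the proof of Mumford's §5 Cor. 3 / Hartshorne III 12.11 / EGA III 7.7.10 is, for a linear map `f`: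

  «`ker f` is finite projective, and for every `R`-algebra `B` the base change `B ⊗_R ker f → B ⊗_R (source)` is
   injective with range `ker (f ⊗ B)`» — `ker f` COMMUTES WITH BASE CHANGE.

* §1 `surjective_of_surjective_baseChange_residueField` — Nakayama: for `Q` finite over the local `R`, `d ⊗ k` onto ⇒ `d`
  onto (★ `surjective_baseChange_iff_subsingleton_tensor_coker` + Mathlib `IsLocalRing.subsingleton_tensorProduct`);
  `ker_baseChange_of_surjective` — the invariant for a surjection onto a projective module (★
  `nonempty_baseChange_kerEquiv_of_surjective`, unbundled).
* §2 **`kerBaseChange_step`** — THE STEP: if `ker e` is finite projective and commutes with base change, and the fibre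
  complex `P ⊗ k → Q ⊗ k → W ⊗ k` is exact at `Q ⊗ k`, then `d` maps `P` ONTO `ker e`, `ker d` is finite projective and
  commutes with base change, and `P ⊗ B → Q ⊗ B → W ⊗ B` is exact at `Q ⊗ B` for EVERY `R`-algebra `B` («vanishing of the
  fibre cohomology in degree `m` spreads to all base changes, and the cycles one degree down commute with base change»).
  Iterating from the top of a strictly perfect complex `K•` with `Hⁱ(K• ⊗ k) = 0` for `i ≥ q` gives `Hⁱ(K• ⊗ B) = 0`
  (`i ≥ q`) for all `B` and `Z^{q−1}` finite projective commuting with base change, hence `H^{q−1}(K• ⊗ B) = B ⊗ H^{q−1}(K•)`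
  (right exactness) — the complex wrapper is the sequel.

Cell `hodgecm-mathlib` (D-0151), F-DAG (h2) «cohomology and base change» (price sheet v0.1 §3 F-2 (2b), §5 item 2; consumer:
relative ampleness EGA III 4.7.1 via the lifting of sections of `L^n` from the fibre).  Count-neutral capital; HC_CM is
proved only modulo the 7 printed citations until rung 0 closes; nothing here is about HC.

## References
* [MumfordAV1970] D. Mumford, *Abelian Varieties* (1970), §5 Cor. 3 (p. 53) and its proof.
* [Hartshorne1977] R. Hartshorne, *Algebraic Geometry*, III Prop. 12.10, Thm. 12.11 (pp. 289–290).
* A. Grothendieck, EGA III₂ (1963), 7.7.5, 7.7.10.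
-/

universe u

open TensorProduct Module

noncomputable section

namespace Literature.Algebra.Module

variable {R : Type u} [CommRing R]

/-! ### §1 Nakayama surjectivity; the invariant for a split surjection -/

/-- **Nakayama**: over a local ring `R` with residue field `k`, a linear map `d : P → Q` to a FINITE module is onto as soon
as `d ⊗ k` is (`coker d ⊗ k = 0 ⇒ coker d = 0`). [cite: MumfordAV1970, §5 Cor. 3 (p. 53)]
[cite: Hartshorne1977, III Prop. 12.10 (p. 289)] -/
theorem surjective_of_surjective_baseChange_residueField [IsLocalRing R] {P Q : Type u} [AddCommGroup P] [Module R P]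
    [AddCommGroup Q] [Module R Q] [Module.Finite R Q] (d : P →ₗ[R] Q)
    (h : Function.Surjective (d.baseChange (IsLocalRing.ResidueField R))) : Function.Surjective d := by
  have hs : Subsingleton (IsLocalRing.ResidueField R ⊗[R] (Q ⧸ LinearMap.range d)) :=
    (surjective_baseChange_iff_subsingleton_tensor_coker d _).1 h
  have hQ : Subsingleton (Q ⧸ LinearMap.range d) := (IsLocalRing.subsingleton_tensorProduct (R := R)).1 hs
  rw [← LinearMap.range_eq_top]
  exact Submodule.Quotient.subsingleton_iff.1 hQ

/-- **The invariant for a surjection onto a projective module** (★ `nonempty_baseChange_kerEquiv_of_surjective` unbundled):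
`ker d` is finite projective, and for every `R`-algebra `B` the map `B ⊗ ker d → B ⊗ P` is injective with range
`ker (d ⊗ B)`. [cite: MumfordAV1970, §5 Cor. 2 (p. 50) and Cor. 3 (p. 53)] -/
theorem ker_baseChange_of_surjective {P Q : Type u} [AddCommGroup P] [Module R P] [AddCommGroup Q] [Module R Q]
    [Module.Finite R P] [Module.Projective R P] [Module.Projective R Q] (d : P →ₗ[R] Q) (hd : Function.Surjective d) :
    (Module.Finite R (LinearMap.ker d) ∧ Module.Projective R (LinearMap.ker d)) ∧
      ∀ (B : Type u) [CommRing B] [Algebra R B],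
        Function.Injective ((LinearMap.ker d).subtype.baseChange B) ∧
          LinearMap.range ((LinearMap.ker d).subtype.baseChange B) = LinearMap.ker (d.baseChange B) := by
  refine ⟨⟨finite_ker_of_surjective d hd, projective_ker_of_surjective d hd⟩, fun B _ _ => ?_⟩
  obtain ⟨e, he⟩ := nonempty_baseChange_kerEquiv_of_surjective d hd B
  have hfun : ((LinearMap.ker d).subtype.baseChange B : B ⊗[R] LinearMap.ker d → B ⊗[R] P) =
      fun z => ((e z : B ⊗[R] P)) := funext fun z => (he z).symm
  refine ⟨?_, ?_⟩
  · rw [hfun]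
    exact fun x y hxy => e.injective (Subtype.ext hxy)
  · ext w
    rw [LinearMap.mem_range]
    constructor
    · rintro ⟨z, rfl⟩
      rw [← he z]
      exact (e z).2
    · intro hw
      exact ⟨e.symm ⟨w, hw⟩, by rw [← he, LinearEquiv.apply_symm_apply]⟩

/-! ### §2 The step -/

section Step

variable {P Q W : Type u} [AddCommGroup P] [Module R P] [AddCommGroup Q] [Module R Q] [AddCommGroup W] [Module R W]
  (d : P →ₗ[R] Q) (e : Q →ₗ[R] W) (hde : e ∘ₗ d = 0)

include hde in
/-- `d` lands in `ker e`. [cite: MumfordAV1970, §5 Cor. 3 (p. 53)] -/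
theorem range_le_ker_of_comp_eq_zero : LinearMap.range d ≤ LinearMap.ker e :=
  LinearMap.range_le_ker_iff.2 hde

include hde in
/-- The base-changed maps still compose to zero. [cite: MumfordAV1970, §5 Cor. 3 (p. 53)] -/
theorem baseChange_comp_baseChange_eq_zero (B : Type u) [CommRing B] [Algebra R B] :
    (e.baseChange B) ∘ₗ (d.baseChange B) = 0 := by
  rw [← LinearMap.baseChange_comp, hde, LinearMap.baseChange_zero]

include hde in
/-- **THE STEP, surjectivity half**: if `ker e` commutes with base change to the residue field (the invariant at `B = k`:
`k ⊗ ker e → k ⊗ Q` injective with range `ker (e ⊗ k)`) and `P ⊗ k → Q ⊗ k → W ⊗ k` is exact, then the corestriction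
`P → ker e` of `d` is onto after `⊗ k`, hence ONTO (Nakayama, `ker e` finite). [cite: MumfordAV1970, §5 Cor. 3 (p. 53)]
[cite: Hartshorne1977, III Thm. 12.11 (p. 290)] -/
theorem surjective_codRestrict_ker_of_exact_residueField [IsLocalRing R] [Module.Finite R (LinearMap.ker e)]
    (hinj : Function.Injective ((LinearMap.ker e).subtype.baseChange (IsLocalRing.ResidueField R)))
    (hran : LinearMap.range ((LinearMap.ker e).subtype.baseChange (IsLocalRing.ResidueField R)) =
      LinearMap.ker (e.baseChange (IsLocalRing.ResidueField R)))
    (hex : Function.Exact (d.baseChange (IsLocalRing.ResidueField R)) (e.baseChange (IsLocalRing.ResidueField R))) :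
    Function.Surjective (d.codRestrict (LinearMap.ker e) fun x => range_le_ker_of_comp_eq_zero d e hde ⟨x, rfl⟩) := by
  set δ := d.codRestrict (LinearMap.ker e) fun x => range_le_ker_of_comp_eq_zero d e hde ⟨x, rfl⟩ with hδ
  have hsub : (LinearMap.ker e).subtype ∘ₗ δ = d := LinearMap.ext fun x => rfl
  apply surjective_of_surjective_baseChange_residueField
  intro z
  -- the image of `z` in `k ⊗ Q` lies in `ker (e ⊗ k) = range (d ⊗ k)`
  have hz : (LinearMap.ker e).subtype.baseChange (IsLocalRing.ResidueField R) z ∈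
      LinearMap.ker (e.baseChange (IsLocalRing.ResidueField R)) := hran ▸ ⟨z, rfl⟩
  obtain ⟨x, hx⟩ := (hex _).1 (LinearMap.mem_ker.1 hz)
  refine ⟨x, hinj ?_⟩
  rw [← LinearMap.comp_apply, ← LinearMap.baseChange_comp, hsub, hx]

include hde in
/-- **THE STEP** (Mumford §5 Cor. 3's induction, one rung): over a LOCAL ring `R` with residue field `k`, let
`P —d→ Q —e→ W` have `e ∘ d = 0`, `P` finite projective, `ker e` finite projective and COMMUTING WITH BASE CHANGE (for every
`R`-algebra `B`: `B ⊗ ker e → B ⊗ Q` injective with range `ker (e ⊗ B)`), and `P ⊗ k → Q ⊗ k → W ⊗ k` exact.  Then: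
(i) `ker d` is finite projective; (ii) `ker d` commutes with base change in the same sense; (iii) `P ⊗ B → Q ⊗ B → W ⊗ B`
is exact for EVERY `R`-algebra `B`. [cite: MumfordAV1970, §5 Cor. 3 (p. 53)] [cite: Hartshorne1977, III Thm. 12.11 (p. 290)] -/
theorem kerBaseChange_step [IsLocalRing R] [Module.Finite R P] [Module.Projective R P]
    (hZ : Module.Finite R (LinearMap.ker e) ∧ Module.Projective R (LinearMap.ker e))
    (hZbc : ∀ (B : Type u) [CommRing B] [Algebra R B],
      Function.Injective ((LinearMap.ker e).subtype.baseChange B) ∧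
        LinearMap.range ((LinearMap.ker e).subtype.baseChange B) = LinearMap.ker (e.baseChange B))
    (hex : Function.Exact (d.baseChange (IsLocalRing.ResidueField R)) (e.baseChange (IsLocalRing.ResidueField R))) :
    (Module.Finite R (LinearMap.ker d) ∧ Module.Projective R (LinearMap.ker d)) ∧
      (∀ (B : Type u) [CommRing B] [Algebra R B],
        Function.Injective ((LinearMap.ker d).subtype.baseChange B) ∧
          LinearMap.range ((LinearMap.ker d).subtype.baseChange B) = LinearMap.ker (d.baseChange B)) ∧
      ∀ (B : Type u) [CommRing B] [Algebra R B], Function.Exact (d.baseChange B) (e.baseChange B) := by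
  haveI := hZ.1
  haveI := hZ.2
  -- the corestriction `δ : P → Z := ker e`, onto by Nakayama
  set δ := d.codRestrict (LinearMap.ker e) fun x => range_le_ker_of_comp_eq_zero d e hde ⟨x, rfl⟩ with hδ
  have hsub : (LinearMap.ker e).subtype ∘ₗ δ = d := LinearMap.ext fun x => rfl
  have hδsurj : Function.Surjective δ :=
    surjective_codRestrict_ker_of_exact_residueField d e hde (hZbc _).1 (hZbc _).2 hex
  -- `ker δ = ker d`
  have hker : LinearMap.ker δ = LinearMap.ker d := by
    ext x
    simp only [LinearMap.mem_ker, hδ]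
    exact ⟨fun h => congrArg Subtype.val h, fun h => Subtype.ext h⟩
  -- the invariant for `δ` (★ FILE 1), transported along `ker δ = ker d` and `B ⊗ Z ↪ B ⊗ Q`
  obtain ⟨⟨hfin, hproj⟩, hbc⟩ := ker_baseChange_of_surjective δ hδsurj
  refine ⟨⟨hker ▸ hfin, hker ▸ hproj⟩, fun B _ _ => ?_, fun B _ _ => ?_⟩
  · obtain ⟨hinjZ, hranZ⟩ := hZbc B
    obtain ⟨hinjδ, hranδ⟩ := hbc B
    -- `subtype_{ker d} ⊗ B = (subtype_Z ∘ … )`: compare through `ker δ = ker d`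
    have hι : (LinearMap.ker d).subtype = (LinearMap.ker δ).subtype ∘ₗ (LinearEquiv.ofEq _ _ hker.symm).toLinearMap :=
      LinearMap.ext fun x => rfl
    have hι' : (LinearMap.ker d).subtype.baseChange B =
        (LinearMap.ker δ).subtype.baseChange B ∘ₗ ((LinearEquiv.ofEq _ _ hker.symm).toLinearMap.baseChange B) := by
      rw [hι, LinearMap.baseChange_comp]
    have hequiv : Function.Bijective ((LinearEquiv.ofEq _ _ hker.symm).toLinearMap.baseChange B :
        B ⊗[R] LinearMap.ker d → B ⊗[R] LinearMap.ker δ) :=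
      ((LinearEquiv.ofEq (LinearMap.ker d) (LinearMap.ker δ) hker.symm).baseChange R B _ _).bijective
    refine ⟨?_, ?_⟩
    · rw [hι', LinearMap.coe_comp]
      exact hinjδ.comp hequiv.1
    · rw [hι', LinearMap.range_comp, LinearMap.range_eq_top.2 hequiv.2, Submodule.map_top, hranδ]
      -- `ker (δ ⊗ B) = ker (d ⊗ B)` since `B ⊗ Z → B ⊗ Q` is injective
      ext x
      rw [LinearMap.mem_ker, LinearMap.mem_ker, ← hsub, LinearMap.baseChange_comp, LinearMap.comp_apply]
      exact ⟨fun h => by rw [h, map_zero], fun h => hinjZ (by rw [h, map_zero])⟩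
  · -- exactness of `P ⊗ B → Q ⊗ B → W ⊗ B`: `range (d ⊗ B) = image of (δ ⊗ B, onto) under `subtype_Z ⊗ B` = `ker (e ⊗ B)`
    obtain ⟨-, hranZ⟩ := hZbc B
    apply LinearMap.exact_of_comp_eq_zero_of_ker_le_range (baseChange_comp_baseChange_eq_zero d e hde B)
    intro y hy
    rw [← hranZ] at hy
    obtain ⟨z, rfl⟩ := hy
    obtain ⟨x, rfl⟩ := surjective_baseChange_of_surjective δ hδsurj B z
    exact ⟨x, by rw [← LinearMap.comp_apply, ← LinearMap.baseChange_comp, hsub]⟩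

end Step

end Literature.Algebra.Module

end
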